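import Summits.CriticalPhenomena.SAWScalingLimit.Theorems.SAWTotalPositivityBoundaryTP2Strip4EvenBridge
import Summits.CriticalPhenomena.SAWScalingLimit.Theorems.SAWTotalPositivityBoundaryTP2StripCertW4Data
import HarnessLib

/-!
# Crux `BoundaryTP2` (stmt-CriticalPhenomena-7115), line `Sketch`: the width-4 sector trajectories in the
data form of the `StripCert` kit (lead c6)

The even/odd sector sequences of the width-4 transfer (`strip4_evenSector_exists`,
`strip4_oddSector_exists`) packaged as vector trajectories `U : ℕ → ℕ → ℝ` driven by the DATA matrices
`TeData` / `ToData` (`mulTV`) from the DATA initial vectors `ue0/we0`, `uo0/wo0` (`evV`), with the kernel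
dictionary of their first two coordinates.  This is the only place where the hand-proved transfer recursion
meets the kernel-decidable certificates. [folklore]
-/

noncomputable section

namespace Summit.CriticalPhenomena.SAWScalingLimit.Theorems.BoundaryTP2

open Literature.Probability.LatticeModels Literature.Probability.RandomPlanarGeometry
open Summit.CriticalPhenomena.SAWScalingLimit.Theorems.EdgeOfPositivity.Negative
open Summit.CriticalPhenomena.SAWScalingLimit.Theorems.BoundaryTP2.Negative.Cert
open Summit.CriticalPhenomena.SAWScalingLimit.Theorems.BoundaryTP2.StripCert
open scoped ENNReal

/-- Six real sequences as one vector sequence. [folklore] -/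
def vec6 (a b p q r t : ℕ → ℝ) : ℕ → ℕ → ℝ := fun n i => [a n, b n, p n, q n, r n, t n].getD i 0

/-- Coordinate `0` of `vec6`. [folklore] -/
@[simp] theorem vec6_0 (a b p q r t : ℕ → ℝ) (n : ℕ) : vec6 a b p q r t n 0 = a n := rfl
/-- Coordinate `1` of `vec6`. [folklore] -/
@[simp] theorem vec6_1 (a b p q r t : ℕ → ℝ) (n : ℕ) : vec6 a b p q r t n 1 = b n := rfl
/-- Coordinate `2` of `vec6`. [folklore] -/
@[simp] theorem vec6_2 (a b p q r t : ℕ → ℝ) (n : ℕ) : vec6 a b p q r t n 2 = p n := rfl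
/-- Coordinate `3` of `vec6`. [folklore] -/
@[simp] theorem vec6_3 (a b p q r t : ℕ → ℝ) (n : ℕ) : vec6 a b p q r t n 3 = q n := rfl
/-- Coordinate `4` of `vec6`. [folklore] -/
@[simp] theorem vec6_4 (a b p q r t : ℕ → ℝ) (n : ℕ) : vec6 a b p q r t n 4 = r n := rfl
/-- Coordinate `5` of `vec6`. [folklore] -/
@[simp] theorem vec6_5 (a b p q r t : ℕ → ℝ) (n : ℕ) : vec6 a b p q r t n 5 = t n := rfl

/-- The even data matrix acts as the even recursion. [folklore] -/
theorem mulTV_TeData (x : ℝ) (z : ℕ → ℝ) :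
    mulTV TeData 6 x z 0 = (x + x ^ 4) * z 0 + (x ^ 2 + x ^ 3) * z 1 + x ^ 4 * z 2 + x ^ 5 * z 3 + x ^ 4 * z 4 + x ^ 5 * z 5 ∧
    mulTV TeData 6 x z 1 = (x ^ 2 + x ^ 3) * z 0 + (x + x ^ 2) * z 1 + x ^ 5 * z 4 + x ^ 4 * z 5 ∧
    mulTV TeData 6 x z 2 = x ^ 3 * z 0 + x ^ 2 * z 1 + x ^ 3 * z 2 + x ^ 4 * z 3 ∧
    mulTV TeData 6 x z 3 = x ^ 2 * z 0 + x ^ 3 * z 1 + x ^ 4 * z 2 + x ^ 3 * z 3 + x ^ 4 * z 4 ∧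
    mulTV TeData 6 x z 4 = x ^ 3 * z 0 + x ^ 4 * z 3 + x ^ 3 * z 4 + x ^ 4 * z 5 ∧
    mulTV TeData 6 x z 5 = x ^ 2 * z 0 + x ^ 4 * z 4 + x ^ 3 * z 5 := by
  simp only [mulTV, ent, TeData, Finset.sum_range_succ, Finset.sum_range_zero]
  norm_num [List.getD]
  refine ⟨?_, ?_, ?_, ?_, ?_, ?_⟩ <;> ring

/-- The odd data matrix acts as the signed odd recursion. [folklore] -/
theorem mulTV_ToData (x : ℝ) (z : ℕ → ℝ) :
    mulTV ToData 6 x z 0 = (x - x ^ 4) * z 0 + (x ^ 2 - x ^ 3) * z 1 - x ^ 4 * z 2 - x ^ 5 * z 3 - x ^ 4 * z 4 - x ^ 5 * z 5 ∧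
    mulTV ToData 6 x z 1 = (x ^ 2 - x ^ 3) * z 0 + (x - x ^ 2) * z 1 - x ^ 5 * z 4 - x ^ 4 * z 5 ∧
    mulTV ToData 6 x z 2 = x ^ 3 * z 0 + x ^ 2 * z 1 + x ^ 3 * z 2 + x ^ 4 * z 3 ∧
    mulTV ToData 6 x z 3 = x ^ 2 * z 0 + x ^ 3 * z 1 + x ^ 4 * z 2 + x ^ 3 * z 3 + x ^ 4 * z 4 ∧
    mulTV ToData 6 x z 4 = x ^ 3 * z 0 + x ^ 4 * z 3 + x ^ 3 * z 4 + x ^ 4 * z 5 ∧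
    mulTV ToData 6 x z 5 = x ^ 2 * z 0 + x ^ 4 * z 4 + x ^ 3 * z 5 := by
  simp only [mulTV, ent, ToData, Finset.sum_range_succ, Finset.sum_range_zero]
  norm_num [List.getD]
  refine ⟨?_, ?_, ?_, ?_, ?_, ?_⟩ <;> ring

/-- **The even sector as a data-driven trajectory**: for the start-row pair `(r₁,r₂) ∈ {(0,3),(1,2)}` there is
`U : ℕ → ℕ → ℝ` with `U 0 = ue0/we0`, `U (t+1) = TeData(x) · U t` on the six coordinates, and
`U n 0 = K(r₁→0) + K(r₂→0)`, `U n 1 = K(r₁→1) + K(r₂→1)` (real kernels of the 4-row strip of length `n`). [folklore] -/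
theorem strip4_evenTraj {x : ℝ} (hx0 : 0 ≤ x) (r₁ r₂ : ℤ) (hr : (r₁ = 0 ∧ r₂ = 3) ∨ (r₁ = 1 ∧ r₂ = 2)) :
    ∃ U : ℕ → ℕ → ℝ,
      (∀ i, i < 6 → U 0 i = evV (if r₁ = 0 then ue0 else we0) x i) ∧
      (∀ t i, i < 6 → U (t + 1) i = mulTV TeData 6 x (U t) i) ∧
      (∀ n : ℕ, U n 0 = (pathKernel (discreteDomainGraph (rectDomain n 3) 1) x (st 0 r₁) (st n 0)).toReal +
          (pathKernel (discreteDomainGraph (rectDomain n 3) 1) x (st 0 r₂) (st n 0)).toReal ∧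
        U n 1 = (pathKernel (discreteDomainGraph (rectDomain n 3) 1) x (st 0 r₁) (st n 1)).toReal +
          (pathKernel (discreteDomainGraph (rectDomain n 3) 1) x (st 0 r₂) (st n 1)).toReal) := by
  obtain ⟨a, b, p, q, r, t, h0, hrec, hdict⟩ := strip4_evenSector_exists hx0 r₁ r₂ hr
  refine ⟨vec6 a b p q r t, ?_, ?_, fun n => ⟨by simpa using (hdict n).1, by simpa using (hdict n).2⟩⟩
  · rcases hr with ⟨rfl, rfl⟩ | ⟨rfl, rfl⟩
    · obtain ⟨e0, e1, e2, e3, e4, e5⟩ := h0.1 rfl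
      intro i hi
      rw [if_pos rfl]
      interval_cases i <;> simp only [vec6_0, vec6_1, vec6_2, vec6_3, vec6_4, vec6_5, e0, e1, e2, e3, e4, e5] <;>
        norm_num [evV, ue0, List.getD] <;> ring
    · obtain ⟨e0, e1, e2, e3, e4, e5⟩ := h0.2 rfl
      intro i hi
      rw [if_neg (by norm_num)]
      interval_cases i <;> simp only [vec6_0, vec6_1, vec6_2, vec6_3, vec6_4, vec6_5, e0, e1, e2, e3, e4, e5] <;>
        norm_num [evV, we0, List.getD] <;> ring
  · intro n i hi
    obtain ⟨m0, m1, m2, m3, m4, m5⟩ := mulTV_TeData x (vec6 a b p q r t n)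
    obtain ⟨ra, rb, rp, rq, rr, rt⟩ := hrec n
    interval_cases i
    · rw [m0]; simpa using ra
    · rw [m1]; simpa using rb
    · rw [m2]; simpa using rp
    · rw [m3]; simpa using rq
    · rw [m4]; simpa using rr
    · rw [m5]; simpa using rt

/-- **The odd sector as a data-driven trajectory** (signed coordinates): `U 0 = uo0/wo0`,
`U (t+1) = ToData(x) · U t`, and `U n 0 = K(r₁→0) - K(r₂→0)`, `U n 1 = K(r₁→1) - K(r₂→1)`. [folklore] -/
theorem strip4_oddTraj {x : ℝ} (hx0 : 0 ≤ x) (r₁ r₂ : ℤ) (hr : (r₁ = 0 ∧ r₂ = 3) ∨ (r₁ = 1 ∧ r₂ = 2)) :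
    ∃ U : ℕ → ℕ → ℝ,
      (∀ i, i < 6 → U 0 i = evV (if r₁ = 0 then uo0 else wo0) x i) ∧
      (∀ t i, i < 6 → U (t + 1) i = mulTV ToData 6 x (U t) i) ∧
      (∀ n : ℕ, U n 0 = (pathKernel (discreteDomainGraph (rectDomain n 3) 1) x (st 0 r₁) (st n 0)).toReal -
          (pathKernel (discreteDomainGraph (rectDomain n 3) 1) x (st 0 r₂) (st n 0)).toReal ∧
        U n 1 = (pathKernel (discreteDomainGraph (rectDomain n 3) 1) x (st 0 r₁) (st n 1)).toReal -
          (pathKernel (discreteDomainGraph (rectDomain n 3) 1) x (st 0 r₂) (st n 1)).toReal) := by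
  obtain ⟨a, b, p, q, r, t, h0, hrec, hdict⟩ := strip4_oddSector_exists hx0 r₁ r₂ hr
  refine ⟨vec6 a b p q r t, ?_, ?_, fun n => ⟨by simpa using (hdict n).1, by simpa using (hdict n).2⟩⟩
  · rcases hr with ⟨rfl, rfl⟩ | ⟨rfl, rfl⟩
    · obtain ⟨e0, e1, e2, e3, e4, e5⟩ := h0.1 rfl
      intro i hi
      rw [if_pos rfl]
      interval_cases i <;> simp only [vec6_0, vec6_1, vec6_2, vec6_3, vec6_4, vec6_5, e0, e1, e2, e3, e4, e5] <;>
        norm_num [evV, uo0, List.getD] <;> ring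
    · obtain ⟨e0, e1, e2, e3, e4, e5⟩ := h0.2 rfl
      intro i hi
      rw [if_neg (by norm_num)]
      interval_cases i <;> simp only [vec6_0, vec6_1, vec6_2, vec6_3, vec6_4, vec6_5, e0, e1, e2, e3, e4, e5] <;>
        norm_num [evV, wo0, List.getD] <;> ring
  · intro n i hi
    obtain ⟨m0, m1, m2, m3, m4, m5⟩ := mulTV_ToData x (vec6 a b p q r t n)
    obtain ⟨ra, rb, rp, rq, rr, rt⟩ := hrec n
    interval_cases i
    · rw [m0]; simpa using ra
    · rw [m1]; simpa using rb
    · rw [m2]; simpa using rp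
    · rw [m3]; simpa using rq
    · rw [m4]; simpa using rr
    · rw [m5]; simpa using rt

end Summit.CriticalPhenomena.SAWScalingLimit.Theorems.BoundaryTP2
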